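import Literature.AnabelianGeometry.EtaleTheta.LogDivisorModelTateTowerThetaTwistTranslation

/-!
# [EtTh] Def. 3.3 (iii) at a Kummer LEVEL of the `Ÿ`-skeleton: the CONSTANT-FIELD (cyclotomic) action on the roots of unity of the
# level, and its commutation relations with the Kummer classes and the (corrected) translations — the design fork of the 2c tower
# made kernel-precise (class (b))

S. Mochizuki, *The étale theta function …*, Publ. RIMS **45** (2009) [MochizukiEtTh2009], §1 p.13 (the cyclotomic character on the
roots of unity of `K_N`), Prop. 1.4 (ii) p.22 (the sign `(−1)^a` of the functional equation), Def. 3.3 (iii) p.73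
[cite: MochizukiEtTh2009, Def 3.3 p.73].

CLASS (b) MODEL (abc-iut cell, layer L2; seat abc-iut-L2-t3 (gen 7); sequel of `…ThetaTwistKummerAction` (p482960) and
`…ThetaTwistTranslation` (p484463) — UNTOUCHED).  Over the level `TateTowerThetaTwist.model (Multiplicative B)`:
* **`constAut φ : Fn ≃* Fn`, `(ζ, f) ↦ (φ ζ, f)`** for an automorphism `φ : B ≃+ B` of the roots of unity (at `B = ZMod (M m)`:
  multiplication by the cyclotomic character `χ_m(c)`), `constAction : MulAut μ →* MulAut Fn` (`μ = Multiplicative B`), and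
  **`constGaloisAction : (model (Multiplicative B)).GaloisAction (MulAut μ)`** — trivial on log-divisors, every law PROVED;
* the COMMUTATION RELATIONS on the functions of the level:
  - `constAut_kummerAut : C_φ ∘ K_κ = K_{φ∘κ} ∘ C_φ` — the constants scale the Kummer classes (abc-iut-L1-t6's `χ`-twist of `K`);
  - `constAut_translAut : C_φ ∘ T^η_a = T^{φ η}_a ∘ C_φ` — the constants move the ROOT-OF-UNITY CORRECTION of the translations;
  - `translAut_eq_kummerAut_translAut : T^{η′}_a = K_{(0, 0, a•(η′ − η))} ∘ T^η_a` — two corrections differ by a Kummer element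
    of the `Θ̈`-class;
  - hence **`constAut_conj_translAut : C_φ ∘ T^η_a ∘ C_φ⁻¹ = K_{(0,0,a•(φ η − η))} ∘ T^η_a`**: with a NON-TRIVIAL correction the
    constants and the translations do NOT commute on functions — their commutator is the Kummer element of class `(0, 0, a(χ−1)η)`;
    with `η = 0` they commute (`constAut_translAut_zero`).
  DESIGN FORK for the tower (STATUS 2026-08-27 ≈01:45Z «SIGN MIGRATION»): (α) keep the sign of Prop. 1.4 (ii) as the correction
  `η_m = ζ_{M_m}` — then the acting group is an extension in which `[C, ℤ_γ] ⊆ K` (not a direct factor `C × ℤ_γ`); (β) sign-free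
  levels `η = 0` — abc-iut-L1-t6's `K ⋊ (C × ℤ_γ)` («GRP₃′») acts verbatim (`constAut_translAut_zero` + p484463's
  `translAction_conj_kummerAction`), at the price of the torsion sign `(−1)^a` (invisible on divisors and on classes modulo torsion).
HONEST LABEL: a combinatorial design model, NOT the tempered fundamental group of a Tate curve; defs + theorems only, no Prop-valued
fact, no instance, no notation, no sorry; nothing here bears on [IUTchIII] Cor. 3.12; no side taken; typed ≠ proved.
-/

noncomputable section

namespace Literature.AnabelianGeometry.EtaleTheta

open CategoryTheory

namespace LogDivisorModel

namespace TateTowerThetaTwist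

open TateTowerTheta

variable {B : Type} [AddCommGroup B]

/-! ## The constant-field action on the roots of unity of the level -/

/-- **`C_φ : (ζ, f) ↦ (φ ζ, f)`** — an automorphism `φ` of the roots of unity (the cyclotomic character of a constant-field
automorphism) acting on the functions of the level. [cite: MochizukiEtTh2009, §1 p.13] -/
def constAut (φ : B ≃+ B) : Fn (Multiplicative B) ≃* Fn (Multiplicative B) :=
  MulEquiv.prodCongr (AddEquiv.toMultiplicative φ) (MulEquiv.refl _)

/-- `C_φ` on the root-of-unity coordinate. [cite: MochizukiEtTh2009, §1 p.13] -/
@[simp] theorem constAut_fst (φ : B ≃+ B) (x : Fn (Multiplicative B)) :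
    (constAut φ x).1 = Multiplicative.ofAdd (φ (Multiplicative.toAdd x.1)) := rfl

/-- `C_φ` fixes the skeleton part. [cite: MochizukiEtTh2009, §1 p.13] -/
@[simp] theorem constAut_snd (φ : B ≃+ B) (x : Fn (Multiplicative B)) : (constAut φ x).2 = x.2 := rfl

/-- `C_φ⁻¹` on the root-of-unity coordinate. [cite: MochizukiEtTh2009, §1 p.13] -/
@[simp] theorem constAut_symm_fst (φ : B ≃+ B) (x : Fn (Multiplicative B)) :
    ((constAut φ).symm x).1 = Multiplicative.ofAdd (φ.symm (Multiplicative.toAdd x.1)) := rfl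

/-- `C_φ⁻¹` fixes the skeleton part. [cite: MochizukiEtTh2009, §1 p.13] -/
@[simp] theorem constAut_symm_snd (φ : B ≃+ B) (x : Fn (Multiplicative B)) : ((constAut φ).symm x).2 = x.2 := rfl

/-- `C_1 = id`. [cite: MochizukiEtTh2009, §1 p.13] -/
theorem constAut_refl : constAut (AddEquiv.refl B) = MulEquiv.refl _ := MulEquiv.ext fun _ => rfl

/-- `C_{ψ ∘ φ} = C_ψ ∘ C_φ`. [cite: MochizukiEtTh2009, §1 p.13] -/
theorem constAut_trans (φ ψ : B ≃+ B) : constAut (φ.trans ψ) = (constAut φ).trans (constAut ψ) := MulEquiv.ext fun _ => rfl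

/-- **The constant-field action `φ ↦ C_φ`** as a homomorphism from the automorphism GROUP `MulAut μ` of the roots of unity
(`AddAut B` carries an additive structure in Mathlib; `μ = Multiplicative B`). [cite: MochizukiEtTh2009, §1 p.13] -/
def constAction : MulAut (Multiplicative B) →* MulAut (Fn (Multiplicative B)) where
  toFun φ := MulEquiv.prodCongr φ (MulEquiv.refl _)
  map_one' := MulEquiv.ext fun _ => rfl
  map_mul' _ _ := MulEquiv.ext fun _ => rfl

/-- `constAction` of the multiplicative form of `φ` is `C_φ`. [cite: MochizukiEtTh2009, §1 p.13] -/
@[simp] theorem constAction_apply (φ : B ≃+ B) (x : Fn (Multiplicative B)) :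
    constAction (AddEquiv.toMultiplicative φ) x = constAut φ x := rfl

/-- `constAction φ` on components. [cite: MochizukiEtTh2009, §1 p.13] -/
theorem constAction_apply' (φ : MulAut (Multiplicative B)) (x : Fn (Multiplicative B)) : constAction φ x = (φ x.1, x.2) := rfl

/-- Roots of unity: `ζ ↦ φ ζ`. [cite: MochizukiEtTh2009, §1 p.13] -/
theorem constAut_zeta (φ : B ≃+ B) (ζ : Multiplicative B) :
    constAut φ (zeta (Multiplicative B) ζ) = zeta (Multiplicative B) (Multiplicative.ofAdd (φ (Multiplicative.toAdd ζ))) := rfl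

/-- The root `Θ̈_m` (and every function of the skeleton) is fixed. [cite: MochizukiEtTh2009, §1 p.13] -/
theorem constAut_theta (φ : B ≃+ B) : constAut φ (theta (Multiplicative B)) = theta (Multiplicative B) :=
  Prod.ext (show Multiplicative.ofAdd (φ (Multiplicative.toAdd (1 : Multiplicative B))) = 1 by rw [toAdd_one, map_zero]; rfl) rfl

variable [Finite B]

/-- **The constant-field action is structure-preserving**: a `GaloisAction` of `MulAut μ` on the level, trivial on log-divisors,
cusps and components, every law PROVED. [cite: MochizukiEtTh2009, Def 3.3 p.73] -/
def constGaloisAction : (model (Multiplicative B)).GaloisAction (MulAut (Multiplicative B)) where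
  actFn := constAction
  actDIV := 1
  permCusp := 1
  permComp := 1
  act_mem_DIVplus _ _ h := h
  act_mem_Div _ _ h := h
  act_mem_logMero _ _ _ := trivial
  act_mem_const _ _ h := h
  act_mem_intConst _ _ h := h
  divisor_act _ _ := rfl
  mult_act _ d x := by cases x <;> rfl

/-- The constant-field action on functions is `C_φ`. [cite: MochizukiEtTh2009, Def 3.3 p.73] -/
theorem constGaloisAction_actFn (φ : B ≃+ B) (x : Fn (Multiplicative B)) :
    (constGaloisAction (B := B)).actFn (AddEquiv.toMultiplicative φ) x = constAut φ x := rfl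

omit [Finite B]

/-! ## Commutation relations on the functions of the level -/

/-- **The constants scale the Kummer classes**: `C_φ (K_κ x) = K_{φ ∘ κ} (C_φ x)`. [cite: MochizukiEtTh2009, §1 p.13] -/
theorem constAut_kummerAut (φ : B ≃+ B) (κ : Fin 3 → B) (x : Fn (Multiplicative B)) :
    constAut φ (kummerAut κ x) = kummerAut (fun i => φ (κ i)) (constAut φ x) := by
  refine Prod.ext ?_ rfl
  show Multiplicative.ofAdd (φ (Multiplicative.toAdd x.1 + pairing κ (Multiplicative.toAdd x.2))) =
    Multiplicative.ofAdd (φ (Multiplicative.toAdd x.1) + pairing (fun i => φ (κ i)) (Multiplicative.toAdd x.2))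
  simp only [pairing, map_add φ, map_zsmul φ]

/-- In conjugation form: `C_φ ∘ K_κ ∘ C_φ⁻¹ = K_{φ∘κ}`. [cite: MochizukiEtTh2009, §1 p.13] -/
theorem constAut_conj_kummerAut (φ : B ≃+ B) (κ : Fin 3 → B) :
    ((constAut φ).symm.trans (kummerAut κ)).trans (constAut φ) = kummerAut (fun i => φ (κ i)) :=
  MulEquiv.ext fun x => by
    change constAut φ (kummerAut κ ((constAut φ).symm x)) = _
    rw [constAut_kummerAut, MulEquiv.apply_symm_apply]

/-- **The constants move the root-of-unity correction of the translations**: `C_φ (T^η_a x) = T^{φ η}_a (C_φ x)`.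
[cite: MochizukiEtTh2009, Prop 1.4 p.22] -/
theorem constAut_translAut (φ : B ≃+ B) (η : B) (a : ℤ) (x : Fn (Multiplicative B)) :
    constAut φ (translAut η a x) = translAut (φ η) a (constAut φ x) := by
  refine Prod.ext ?_ rfl
  show Multiplicative.ofAdd (φ (Multiplicative.toAdd x.1 + corr η a (Multiplicative.toAdd x.2))) =
    Multiplicative.ofAdd (φ (Multiplicative.toAdd x.1) + corr (φ η) a (Multiplicative.toAdd x.2))
  rw [map_add φ, corr, corr, map_zsmul φ]

/-- With the TRIVIAL correction the constants and the translations commute. [cite: MochizukiEtTh2009, Prop 1.4 p.22] -/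
theorem constAut_translAut_zero (φ : B ≃+ B) (a : ℤ) (x : Fn (Multiplicative B)) :
    constAut φ (translAut 0 a x) = translAut 0 a (constAut φ x) := by
  rw [constAut_translAut, map_zero]

/-- **Two corrections differ by a Kummer element of the `Θ̈`-class**: `T^{η′}_a = K_{(0,0,a•(η′−η))} ∘ T^η_a`.
[cite: MochizukiEtTh2009, Prop 1.4 p.22] -/
theorem translAut_eq_kummerAut_translAut (η η' : B) (a : ℤ) (x : Fn (Multiplicative B)) :
    translAut η' a x = kummerAut (Pi.single (2 : Fin 3) (a • (η' - η))) (translAut η a x) := by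
  refine Prod.ext ?_ rfl
  rw [translAut_fst, kummerAut_fst, translAut_fst, translAut_snd, toAdd_shear₀Fn, mul_assoc, ← ofAdd_add]
  congr 2
  rw [pairing, corr, corr, eT_shear₀]
  simp only [Pi.single_apply, Fin.reduceEq, if_false, if_true, smul_zero, zero_add, smul_sub, smul_smul]
  module

/-- **The commutator of a constant and a translation is a Kummer element**: `C_φ (T^η_a (C_φ⁻¹ x)) = K_{(0,0,a•(φ η − η))} (T^η_a x)`
— non-trivial as soon as `φ η ≠ η` and `a t ≠ 0`: under design (α) the acting group is an extension with `[C, ℤ_γ] ⊆ K`, not a direct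
factor `C × ℤ_γ`. [cite: MochizukiEtTh2009, Prop 1.4 p.22] -/
theorem constAut_conj_translAut (φ : B ≃+ B) (η : B) (a : ℤ) (x : Fn (Multiplicative B)) :
    constAut φ (translAut η a ((constAut φ).symm x)) =
      kummerAut (Pi.single (2 : Fin 3) (a • (φ η - η))) (translAut η a x) := by
  rw [constAut_translAut, MulEquiv.apply_symm_apply, translAut_eq_kummerAut_translAut η (φ η)]

/-- Under design (β) (`η = 0`) the constants and the translations commute in `MulAut Fn` — abc-iut-L1-t6's direct factor `C × ℤ_γ`
acts. [cite: MochizukiEtTh2009, Def 3.3 p.73] -/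
theorem constAction_mul_translAction_zero (φ : B ≃+ B) (a : Multiplicative ℤ) :
    constAction (AddEquiv.toMultiplicative φ) * translAction (0 : B) a =
      translAction (0 : B) a * constAction (AddEquiv.toMultiplicative φ) :=
  MulEquiv.ext fun x => constAut_translAut_zero φ (Multiplicative.toAdd a) x

/-- The constants commute with the Kummer action up to the scaling of classes, in `MulAut Fn`:
`C_φ * K_κ * C_φ⁻¹ = K_{φ∘κ}`. [cite: MochizukiEtTh2009, §1 p.13] -/
theorem constAction_conj_kummerAction (φ : B ≃+ B) (κ : Multiplicative (Fin 3 → B)) :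
    constAction (AddEquiv.toMultiplicative φ) * kummerAction κ * (constAction (AddEquiv.toMultiplicative φ))⁻¹ =
      kummerAction (Multiplicative.ofAdd fun i => φ (Multiplicative.toAdd κ i)) := by
  refine MulEquiv.ext fun x => ?_
  show constAut φ (kummerAut (Multiplicative.toAdd κ) ((constAut φ).symm x)) =
    kummerAut (Multiplicative.toAdd (Multiplicative.ofAdd fun i => φ (Multiplicative.toAdd κ i))) x
  rw [toAdd_ofAdd, constAut_kummerAut, MulEquiv.apply_symm_apply]

end TateTowerThetaTwist

end LogDivisorModel

end Literature.AnabelianGeometry.EtaleTheta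

end
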